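import Mathlib
import Summits.Ventures.PercRepro2.K5TypedK3
import Summits.Ventures.PercRepro2.Inst8K3Tables

/-!
# THE TYPED `K₃` BASE ON AN INSTANCE GRAPH FROM ITS KERNEL CERTIFICATE
(blind cell PercRepro2, typer-1 g14; `K5TypedK3.lean` for an instance graph `G : Inst`)

By `Inst8K3Tables.K3_apply`, on `G` with the marks `(0, 1, 2, 3, b)` the kernel `K₃ x y w` is a signed sum
of twenty products of tables, so a typed count `typedCount F z τ K₃` is the signed triple count of the
profile `k` of the minor `(F, z, τ)` (`typedCount_K3_eq`: `cntPos3 G b k − cntNeg3 G b k`).  The kernel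
certificate `Cert3 G b` (`Inst8Kernel.lean`) reads the counts off the base-`KB` digits of `kPos3 G b`,
`kNeg3 G b` (`K5.le_of_kron_le'`: the digits of `kNeg3 G b` are below `2^19` by the third mask test, the
counts are below `KB`, so the subtraction borrows nowhere), hence

* **`cntNeg3_le_cntPos3`**: `Cert3 G b → ∀ k, cntNeg3 G b k ≤ cntPos3 G b k`;
* **`typedCount_K3_nonneg_of_cert`**: `Cert3 G b →` every weight-free typed count of `K₃` on `G` at the
  marks `(0, 1, 2, 3, b)` is `≥ 0` — all minors `(F, z)`, all type maps;
* **`typedBases_of_cert`**: `Cert3 G b → CovForm.TypedBases (ends G) 0 1 2 3 b` (row 2′TRI on `G`);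
* **`HCov_of_cert`**: `Cert3 G b →` (HCOV) on `G` for every admissible weight vector.
-/

namespace Summit.Ventures.PercRepro2

open Hub

namespace Inst8

/-! ## Typed counts are signed triple counts -/

section Counts

variable {R : Type*} [Field R]

/-- The positive triple counts of `K₃` on `G` at the marks `(0, 1, 2, 3, b)`. -/
def cntPos3 (G : Inst) (b : ℕ) (k : Fin 10 → Fin 4) : ℕ :=
  K5.cnt3 (tPD G) (tQ G) (t4p G b) k + K5.cnt3 (tQ G) (tPDoU G) (t5p G b) k +
    K5.cnt3 (tPD G) (tQ G) (t6m G b) k +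
    K5.cnt3 (tPD G) (t7p G b) (t7m G 0) k + K5.cnt3 (tPD G) (t7m G b) (t7p G 0) k +
    K5.cnt3 (tPDoU G) (t7p G b) (t7m G 3) k + K5.cnt3 (tPDoU G) (t7m G b) (t7p G 3) k +
    K5.cnt3 (tPD G) (t7p G b) (t10p G) k + K5.cnt3 (tPD G) (t7m G b) (t10m G) k +
    K5.cnt3 (tQ G) (t12 G b) (tPDoU G) k

/-- The negative triple counts of `K₃` on `G` at the marks `(0, 1, 2, 3, b)`. -/
def cntNeg3 (G : Inst) (b : ℕ) (k : Fin 10 → Fin 4) : ℕ :=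
  K5.cnt3 (tPD G) (tQ G) (t4m G b) k + K5.cnt3 (tQ G) (tPDoU G) (t5m G b) k +
    K5.cnt3 (tPD G) (tQ G) (t6p G b) k +
    K5.cnt3 (tPD G) (t7p G b) (t7p G 0) k + K5.cnt3 (tPD G) (t7m G b) (t7m G 0) k +
    K5.cnt3 (tPDoU G) (t7p G b) (t7p G 3) k + K5.cnt3 (tPDoU G) (t7m G b) (t7m G 3) k +
    K5.cnt3 (tPD G) (t7p G b) (t10m G) k + K5.cnt3 (tPD G) (t7m G b) (t10p G) k +
    K5.cnt3 (tPD G) (tQ G) (t11 G b) k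

/-- **A typed count of `K₃` on `G` is the signed triple count of its profile.** -/
lemma typedCount_K3_eq (G : Inst) (b : Fin 8) (F : Finset (Fin 10)) (z : Config (Fin 10))
    (τ : Fin 10 → ℕ) (k : Fin 10 → Fin 4)
    (hk : ∀ e, (k e : ℕ) = if e ∈ F then τ e else if z e then 3 else 0) :
    typedCount F z τ (CovForm.K3 (R := R) (ends G) 0 1 2 3 b) =
      ((cntPos3 G b k : ℕ) : R) - ((cntNeg3 G b k : ℕ) : R) := by
  have hK : CovForm.K3 (R := R) (ends G) 0 1 2 3 b = fun x y w =>
      (K5.indR (tPD G) x * K5.indR (tQ G) y * K5.indR (t4p G b) w +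
        K5.indR (tQ G) x * K5.indR (tPDoU G) y * K5.indR (t5p G b) w +
        K5.indR (tPD G) x * K5.indR (tQ G) y * K5.indR (t6m G b) w +
        K5.indR (tPD G) x * K5.indR (t7p G b) y * K5.indR (t7m G 0) w +
        K5.indR (tPD G) x * K5.indR (t7m G b) y * K5.indR (t7p G 0) w +
        K5.indR (tPDoU G) x * K5.indR (t7p G b) y * K5.indR (t7m G 3) w +
        K5.indR (tPDoU G) x * K5.indR (t7m G b) y * K5.indR (t7p G 3) w +
        K5.indR (tPD G) x * K5.indR (t7p G b) y * K5.indR (t10p G) w +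
        K5.indR (tPD G) x * K5.indR (t7m G b) y * K5.indR (t10m G) w +
        K5.indR (tQ G) x * K5.indR (t12 G b) y * K5.indR (tPDoU G) w) -
      (K5.indR (tPD G) x * K5.indR (tQ G) y * K5.indR (t4m G b) w +
        K5.indR (tQ G) x * K5.indR (tPDoU G) y * K5.indR (t5m G b) w +
        K5.indR (tPD G) x * K5.indR (tQ G) y * K5.indR (t6p G b) w +
        K5.indR (tPD G) x * K5.indR (t7p G b) y * K5.indR (t7p G 0) w +
        K5.indR (tPD G) x * K5.indR (t7m G b) y * K5.indR (t7m G 0) w +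
        K5.indR (tPDoU G) x * K5.indR (t7p G b) y * K5.indR (t7p G 3) w +
        K5.indR (tPDoU G) x * K5.indR (t7m G b) y * K5.indR (t7m G 3) w +
        K5.indR (tPD G) x * K5.indR (t7p G b) y * K5.indR (t10m G) w +
        K5.indR (tPD G) x * K5.indR (t7m G b) y * K5.indR (t10p G) w +
        K5.indR (tPD G) x * K5.indR (tQ G) y * K5.indR (t11 G b) w) := by
    funext x y w
    exact K3_apply G b x y w
  rw [hK, K5.typedCount_sub]
  simp only [K5.typedCount_add, K5.typedCount_tables F z τ k hk]
  unfold cntPos3 cntNeg3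
  push_cast
  ring

end Counts

/-! ## The digit bridge -/

section Digits

/-- `kPos3 G b` carries the positive counts. -/
lemma kPos3_eq (G : Inst) (b : ℕ) : kPos3 G b = ∑ k, cntPos3 G b k * K5.KB ^ K5.idx4 k := by
  unfold kPos3
  simp only [K5.kron_eq_kronSum, K5.kronSum_mul_mul]
  rw [K5.sum_add_mul10]
  rfl

/-- `kNeg3 G b` carries the negative counts. -/
lemma kNeg3_eq (G : Inst) (b : ℕ) : kNeg3 G b = ∑ k, cntNeg3 G b k * K5.KB ^ K5.idx4 k := by
  unfold kNeg3
  simp only [K5.kron_eq_kronSum, K5.kronSum_mul_mul]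
  rw [K5.sum_add_mul10]
  rfl

/-- The positive counts are below `KB` (ten counts `≤ 3^10`). -/
lemma cntPos3_lt (G : Inst) (b : ℕ) (k : Fin 10 → Fin 4) : cntPos3 G b k < K5.KB := by
  unfold cntPos3
  rw [K5.KB_val]
  have := K5.cnt3_le (tPD G) (tQ G) (t4p G b) k
  have := K5.cnt3_le (tQ G) (tPDoU G) (t5p G b) k
  have := K5.cnt3_le (tPD G) (tQ G) (t6m G b) k
  have := K5.cnt3_le (tPD G) (t7p G b) (t7m G 0) k
  have := K5.cnt3_le (tPD G) (t7m G b) (t7p G 0) k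
  have := K5.cnt3_le (tPDoU G) (t7p G b) (t7m G 3) k
  have := K5.cnt3_le (tPDoU G) (t7m G b) (t7p G 3) k
  have := K5.cnt3_le (tPD G) (t7p G b) (t10p G) k
  have := K5.cnt3_le (tPD G) (t7m G b) (t10m G) k
  have := K5.cnt3_le (tQ G) (t12 G b) (tPDoU G) k
  omega

/-- The negative counts are below `KB`. -/
lemma cntNeg3_lt (G : Inst) (b : ℕ) (k : Fin 10 → Fin 4) : cntNeg3 G b k < K5.KB := by
  unfold cntNeg3
  rw [K5.KB_val]
  have := K5.cnt3_le (tPD G) (tQ G) (t4m G b) k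
  have := K5.cnt3_le (tQ G) (tPDoU G) (t5m G b) k
  have := K5.cnt3_le (tPD G) (tQ G) (t6p G b) k
  have := K5.cnt3_le (tPD G) (t7p G b) (t7p G 0) k
  have := K5.cnt3_le (tPD G) (t7m G b) (t7m G 0) k
  have := K5.cnt3_le (tPDoU G) (t7p G b) (t7p G 3) k
  have := K5.cnt3_le (tPDoU G) (t7m G b) (t7m G 3) k
  have := K5.cnt3_le (tPD G) (t7p G b) (t10m G) k
  have := K5.cnt3_le (tPD G) (t7m G b) (t10p G) k
  have := K5.cnt3_le (tPD G) (tQ G) (t11 G b) k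
  omega

/-- **Every typed coefficient of `K₃` on `G` is `≥ 0`, given the certificate**:
`cntNeg3 G b k ≤ cntPos3 G b k`. -/
theorem cntNeg3_le_cntPos3 (G : Inst) (b : ℕ) (hc : Cert3 G b) (k : Fin 10 → Fin 4) :
    cntNeg3 G b k ≤ cntPos3 G b k :=
  K5.le_of_kron_le' (cntPos3 G b) (cntNeg3 G b) (cntPos3_lt G b) (cntNeg3_lt G b) (kPos3_eq G b)
    (kNeg3_eq G b) hc.1 hc.2.1 hc.2.2 k

end Digits

/-! ## The typed base and (HCOV) -/

section Base

variable {R : Type*} [Field R] [LinearOrder R] [IsStrictOrderedRing R]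

/-- **Every weight-free typed count of `K₃` on `G` at the marks `(0, 1, 2, 3, b)` is nonnegative**,
given the certificate `Cert3 G b` — all minors `(F, z)`, all type maps. -/
theorem typedCount_K3_nonneg_of_cert (G : Inst) (b : Fin 8) (hc : Cert3 G b) (F : Finset (Fin 10))
    (z : Config (Fin 10)) (τ : Fin 10 → ℕ) :
    0 ≤ typedCount F z τ (CovForm.K3 (R := R) (ends G) 0 1 2 3 b) := by
  by_cases hτ : ∀ e ∈ F, τ e ≤ 3
  · obtain ⟨k, hk⟩ := K5.exists_profile F z τ hτ
    rw [typedCount_K3_eq G b F z τ k hk, sub_nonneg]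
    exact_mod_cast cntNeg3_le_cntPos3 G b hc k
  · have : typedCount F z τ (CovForm.K3 (R := R) (ends G) 0 1 2 3 b) = 0 := by
      unfold typedCount
      refine Finset.sum_eq_zero fun x _ => Finset.sum_eq_zero fun y _ =>
        Finset.sum_eq_zero fun w _ => ?_
      rw [if_neg]
      rintro ⟨-, h2⟩
      apply hτ
      intro e he
      rw [← h2 e he]
      unfold openCount
      have := Bool.toNat_le (x e)
      have := Bool.toNat_le (y e)
      have := Bool.toNat_le (w e)
      omega
    rw [this]

/-- **Row 2′TRI on an instance graph** at the marks `(0, 1, 2, 3, b)`, given the certificate. -/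
theorem typedBases_of_cert (G : Inst) (b : Fin 8) (hc : Cert3 G b) :
    CovForm.TypedBases (R := R) (ends G) 0 1 2 3 b :=
  fun F z τ _ => typedCount_K3_nonneg_of_cert G b hc F z τ

/-- **(HCOV) on an instance graph for every admissible weight vector**, given the certificate. -/
theorem HCov_of_cert (G : Inst) (b : Fin 8) (hc : Cert3 G b) (p : Fin 10 → R) (hp : IsProbVec p) :
    CovForm.HCov p (ends G) 0 1 2 3 b :=
  CovForm.HCov_of_typedBases (ends G) 0 1 2 3 b (typedBases_of_cert G b hc) p hp

end Base

end Inst8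

end Summit.Ventures.PercRepro2
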